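import Literature.Computability.AlgebraicComplexity.BLMW11PerOrbitCeiling
import Literature.Computability.AlgebraicComplexity.BLMW11DegreeDivisibilityProofs
import Literature.Computability.AlgebraicComplexity.BLMW11SymKroneckerProofs
import HarnessLib

/-!
# The two renderings of `dim (S_λ W)^H` agree; BLMW 2011 (5.5.3) ⇐ (5.5.2) and (5.2.7) ⇐ (5.2.6)
# in the literal rendering of the named facts (proved)

Cell `val-lit`, D-0074 GROUP L, row BLMW11-A (P. Bürgisser, J. M. Landsberg, L. Manivel, J. Weyman,
*An overview of mathematical issues arising in the geometric complexity theory approach to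
VP ≠ VNP*, SIAM J. Comput. 40 (2011) = arXiv:0907.2850v2, §4.1 (4.1.2), §5.2, §5.5). Theorems only,
no definitions, no named facts. Honest framing: bookkeeping between two formalizations of the same
number; VP ≠ VNP is NOT proved and nothing here is progress on it.

## What is identified

The tree carries the dimension `dim (S_λ W)^H` of the invariants of a subgroup `H ≤ GL(W)`,
`W = k^σ`, in the Weyl module `S_λ W = c_λ · W^{⊗n}` in two renderings:

* `IK2020.weylInvariantDim k N λ H'` (`IK20HighestWeightVectors.lean`): `W = k^N` indexed by `Fin N`,
  the Weyl module `weylModule k (Fin N) λ` with `weylRep`, `H' ≤ GL (Fin N) k` — the form in which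
  the tree PROVES the orbit-closure bound `mult_{λ^*} k[\overline{GL·f}] ≤ dim {λ}^{stab f}`
  (`IK2020.orbitMultiplicity_toMatIdx_le_weylInvariantDim`, stabilizers of forms on `Mat_m` being
  pulled back along the lexicographic enumeration `matIdxEquiv m : Fin (m·m) ≃o MatIdx m` by
  `reindexGL`), and in which `BLMW11PerOrbitCeiling.lean` PROVES
  `perOrbitCeiling = dim {λ}^{H_per}` (`perOrbitCeiling_eq_weylInvariantDim`);
* `Module.finrank k (subgroupInvariants (schurRep (stdRep σ k) λ) H)`
  (`BLMW11StabilityInheritance.lean`, `SchurFunctor.lean`): `W = k^σ` for the index type `σ` itself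
  (`σ = MatIdx m` for matrix spaces), the Schur functor `schurRep` of the standard representation —
  the form in which the named facts `BLMW2011_prop_5_2_1_invariants` ((5.2.6): `= sk^π_{δⁿδⁿ}`) and
  `BLMW2011_prop_5_5_2_invariants` ((5.5.2): `= mult_π`) are TYPED.

`finrank_subgroupInvariants_schurRep_stdRep_eq_weylInvariantDim` (§1) proves the two agree along any
order isomorphism `e : Fin N ≃o σ`: the tensor power of the relabelling `k^N ≃ k^σ`
(Mathlib `PiTensorProduct.congr` of `LinearEquiv.funCongrLeft`) commutes with the action of `𝔖_n`
(`PiTensorProduct.map_comp_reindex_eq`, here on pure tensors), hence with the Young symmetrizer, so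
it maps `c_λ · (k^N)^{⊗n}` onto `c_λ · (k^σ)^{⊗n}`; and it intertwines `g ∈ GL_N` with
`reindexGL e g ∈ GL_σ` (`Matrix.submatrix_mulVec_equiv`), so it maps the invariants of
`e^* H = H.comap (reindexGL e)` onto the invariants of `H` (`reindexGL e` is onto).

## Consequences (§2 permanent, §3 determinant)

* `orbitMultiplicity_toMatIdx_le_finrank_subgroupInvariants`: for EVERY form `f` on `Mat_m` and every
  `λ` with `ℓ(λ) ≤ m²`, `mult_{λ^*} k[\overline{GL(W)·f}] ≤ dim (S_λW)^{GL(W)(f)}` in the literal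
  `subgroupInvariants (schurRep (stdRep (MatIdx m) k) λ) (linStabilizer f)` rendering — BLMW's
  "`ℂ[\overline{GL(W)·f}]_δ ⊆ ℂ[GL(W)·f]_δ = ⊕_π (S_πW^*)^{dim (S_πW)^{GL(W)(f)}}`" (§4.1 (4.1.2) with
  (5.2.7)/(5.5.3): "immediate"), i.e. Ikenmeyer–Kandasamy's bound moved to BLMW's letters.
* `BLMW2011_per_closure_of_invariants`: the dimension formula (5.5.2) (AS PROVED = corrected
  `mult_π`, see the ERRATUM in `BLMW11StabilityInheritance.lean`; spelled out in its degree-guarded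
  reading `0 < δ`, see "ERRATUM A19" below) IMPLIES the closure bound (5.5.3) — exactly the printed
  "(5.5.3) is immediate from (5.5.2)"; likewise `BLMW2011_prop_5_2_1_closure_of_invariants`: (5.2.6)
  implies (5.2.7) with BLMW's `sk^π_{δⁿδⁿ} = symKroneckerCoeff ℂ π (δⁿ)` of (5.2.5) on the right.
* `perOrbitCeiling_eq_finrank_subgroupInvariants` (`ℂ`, `m ≥ 3`): the literal left side of (5.5.2),
  `dim (S_λW)^{GL(W)(per_m)}`, EQUALS the proved ceiling `perOrbitCeiling ℂ m d λ` of
  `BLMW11PerOrbitCeiling.lean`; hence `BLMW2011_per_invariants_iff_perOrbitCeiling`: what remains of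
  (5.5.2) is the numerical identity `perOrbitCeiling ℂ m δ π = BLMW2011.multPer ℂ m δ π` (`0 < δ`;
  by `two_mul_factorial_mul_perOrbitCeiling` a character identity,
  `∑_τ χ^π(τ)(χ₀(τ)² + χ₀(τ²)) = 2·(mδ)!·mult_π`, i.e. Cor. 8.4.2 `χ₀ = ∑_μ p_μ χ^μ` plus character
  orthogonality), and in any characteristic-zero field
  `finrank_subgroupInvariants_per_le_perOrbitCeiling`.
  **ERRATUM A19 (typed side, cell `val-lit`, 2026-08-26).** The named facts
  `BLMW2011_prop_5_5_2_invariants` / `BLMW2011_prop_5_5_2_closure` of `BLMW11StabilityInheritance.lean`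
  were first typed for ALL degrees `δ`, including `δ = 0`, where the tree's `plethysmCoeffOfPartition`
  (hence `BLMW2011.multPer ℂ m 0 ∅`) takes the documented `finrank` junk value `0` although the print
  has `mult_∅ = 1` (`BLMW11PerOrbitDegreeZero.lean`: `multPer_zero_eq_zero`, `perOrbitCeiling_zero_pos`).
  The two §2 lemmas are therefore stated on the SPELLED-OUT sentences with the guard `0 < δ`; the
  by-name forms `BLMW2011_prop_5_5_2_invariants_iff_perOrbitCeiling`,
  `BLMW2011_prop_5_5_2_closure_of_invariants` follow them, the statement file now carrying the guard.
* `finrank_subgroupInvariants_det_le_symKroneckerCoeffRect`: the literal left side of (5.2.6) is at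
  most the tree's `symKroneckerCoeffRect` (t08's `IK2020.weylInvariantDim_det_le_symKroneckerCoeffRect`
  moved to BLMW's letters).
* §4 `symKroneckerCoeffRect_eq_symKroneckerCoeff`: the tree's bound-space `symKroneckerCoeffRect k m d λ`
  IS BLMW's `sk^λ_{(d^m)(d^m)} = symKroneckerCoeff k λ (d^m)` of (5.2.5) (both satisfy the character
  formula `2·(md)!·x = ∑_τ χ^λ(τ)(χ^□(τ)² + χ^□(τ²))`, `two_mul_factorial_mul_symKroneckerCoeffRect` and
  `two_mul_factorial_mul_symKroneckerCoeff` of `BLMW11SymKroneckerProofs.lean`); hence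
  `orbitMultiplicity_det_le_symKroneckerCoeff` — **BLMW (5.2.7) exactly as printed and typed,
  unconditionally** (`mult_{π^*} ℂ[\overline{GL(W)·det_n}]_n ≤ sk^π_{δⁿδⁿ}`) — and
  `finrank_subgroupInvariants_det_le_symKroneckerCoeff`, the `≤` half of (5.2.6) in the letters of
  `BLMW2011_prop_5_2_1_invariants`, whose remaining content is the reverse inequality
  (`BLMW2011_prop_5_2_1_invariants_iff_symKroneckerCoeff_le`; it needs every stabilizer element to
  fix only family-fixed words, i.e. Frobenius' theorem, the fact `frobenius_detPreserver_unimodular_sandwich`).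

## References
* [BurgisserEtAl2011] BLMW, SIAM J. Comput. 40 (2011), §4.1 (4.1.2), Prop. 5.2.1 (5.2.6)–(5.2.7),
  Prop. 5.5.2 (5.5.2)–(5.5.3).
* [IkenmeyerKandasamy2019] C. Ikenmeyer, U. Kandasamy, STOC 2020 = arXiv:1911.03990, §1, §9 (9.4).
* [FultonHarrisGTM129] W. Fulton, J. Harris, *Representation Theory*, §6.1, Lemma 6.22.
-/

open scoped BigOperators Matrix TensorProduct

namespace Literature.Computability.AlgebraicComplexity

open _root_.Literature.NumberTheory.DiophantineGeometry
open _root_.Literature.RepresentationTheory.GeneralLinear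

/-! ### §1 Transport of Weyl-module invariants along `Fin N ≃o σ` -/

section CongrConst

variable {k V W : Type*} [Field k] [AddCommGroup V] [Module k V] [AddCommGroup W] [Module k W]
  {n : ℕ} (φ : V ≃ₗ[k] W)

/-- The tensor power of a linear isomorphism commutes with the permutation action (Mathlib
`PiTensorProduct.map_comp_reindex_eq`, on pure tensors). [folklore] -/
private theorem congr_permTensorRep (τ : Equiv.Perm (Fin n)) (x : TensorPower k n V) :
    PiTensorProduct.congr (fun _ : Fin n => φ) (permTensorRep k V n τ x) =
      permTensorRep k W n τ (PiTensorProduct.congr (fun _ : Fin n => φ) x) := by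
  have h : (PiTensorProduct.congr (fun _ : Fin n => φ)).toLinearMap ∘ₗ permTensorRep k V n τ =
      permTensorRep k W n τ ∘ₗ (PiTensorProduct.congr (fun _ : Fin n => φ)).toLinearMap := by
    refine PiTensorProduct.ext (MultilinearMap.ext fun v => ?_)
    simp only [LinearMap.compMultilinearMap_apply, LinearMap.coe_comp, Function.comp_apply,
      LinearEquiv.coe_coe, permTensorRep_tprod, PiTensorProduct.congr_tprod]
  exact DFunLike.congr_fun h x

/-- Hence it commutes with the whole group algebra `k[𝔖_n]`, in particular with the Young
symmetrizer. [folklore] -/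
private theorem congr_asAlgebraHom_permTensorRep (a : MonoidAlgebra k (Equiv.Perm (Fin n)))
    (x : TensorPower k n V) :
    PiTensorProduct.congr (fun _ : Fin n => φ) ((permTensorRep k V n).asAlgebraHom a x) =
      (permTensorRep k W n).asAlgebraHom a (PiTensorProduct.congr (fun _ : Fin n => φ) x) := by
  induction a using MonoidAlgebra.induction_on with
  | hM τ =>
    rw [Representation.asAlgebraHom_of, Representation.asAlgebraHom_of]
    exact congr_permTensorRep φ τ x
  | hadd a b ha hb =>
    rw [map_add, map_add, LinearMap.add_apply, LinearMap.add_apply, map_add, ha, hb]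
  | hsmul r a ha =>
    rw [map_smul, map_smul, LinearMap.smul_apply, LinearMap.smul_apply, map_smul, ha]

/-- The tensor power of a linear isomorphism maps the Schur module `c_μ · V^{⊗n}` onto
`c_μ · W^{⊗n}`. [folklore] -/
private theorem map_congr_schurModule (μ : Nat.Partition n) :
    (schurModule k V μ).map (PiTensorProduct.congr (fun _ : Fin n => φ)).toLinearMap =
      schurModule k W μ := by
  apply le_antisymm
  · rintro _ ⟨x, ⟨y, rfl⟩, rfl⟩
    exact ⟨PiTensorProduct.congr (fun _ : Fin n => φ) y,
      (congr_asAlgebraHom_permTensorRep φ _ y).symm⟩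
  · rintro _ ⟨y, rfl⟩
    refine ⟨(permTensorRep k V n).asAlgebraHom (youngSymmetrizer k μ)
        ((PiTensorProduct.congr (fun _ : Fin n => φ)).symm y), ⟨_, rfl⟩, ?_⟩
    rw [LinearEquiv.coe_coe, congr_asAlgebraHom_permTensorRep, LinearEquiv.apply_symm_apply]

/-- Membership form of `map_congr_schurModule`. [folklore] -/
private theorem congr_mem_schurModule_iff (μ : Nat.Partition n) (x : TensorPower k n V) :
    PiTensorProduct.congr (fun _ : Fin n => φ) x ∈ schurModule k W μ ↔ x ∈ schurModule k V μ := by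
  rw [← map_congr_schurModule φ μ, Submodule.mem_map_equiv, LinearEquiv.symm_apply_apply]

end CongrConst

section Transport

variable {σ k : Type*} [Fintype σ] [LinearOrder σ] [Field k] {N n : ℕ} (e : Fin N ≃o σ)

omit [Fintype σ] in
/-- The relabelling `k^N ≃ k^σ`, `x ↦ x ∘ e⁻¹` (unfolding). [folklore] -/
private theorem funCongrLeft_symm_apply' (x : Fin N → k) :
    LinearEquiv.funCongrLeft k k e.symm.toEquiv x = fun s => x (e.symm s) :=
  rfl

/-- The relabelling intertwines `g` with `reindex e e g`:
`(g v) ∘ e⁻¹ = (reindex g) (v ∘ e⁻¹)`. [folklore] -/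
private theorem funCongrLeft_mulVec (M : Matrix (Fin N) (Fin N) k) (w : Fin N → k) :
    LinearEquiv.funCongrLeft k k e.symm.toEquiv (M *ᵥ w) =
      (M.submatrix e.symm e.symm) *ᵥ (LinearEquiv.funCongrLeft k k e.symm.toEquiv w) := by
  rw [funCongrLeft_symm_apply', funCongrLeft_symm_apply']
  funext s
  simp only [Matrix.mulVec, dotProduct, Matrix.submatrix_apply]
  exact (Fintype.sum_equiv e.symm.toEquiv _ _ fun t => rfl).symm

/-- The tensor power of the relabelling intertwines `glTensorRep (Fin N) k n g` with
`glTensorRep σ k n (reindexGL e g)`. [folklore] -/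
private theorem congr_glTensorRep (g : GL (Fin N) k) (x : TensorPower k n (Fin N → k)) :
    PiTensorProduct.congr (fun _ : Fin n => LinearEquiv.funCongrLeft k k e.symm.toEquiv)
        (glTensorRep (Fin N) k n g x) =
      glTensorRep σ k n (reindexGL e g)
        (PiTensorProduct.congr (fun _ : Fin n => LinearEquiv.funCongrLeft k k e.symm.toEquiv) x) := by
  have h : (PiTensorProduct.congr
        (fun _ : Fin n => LinearEquiv.funCongrLeft k k e.symm.toEquiv)).toLinearMap ∘ₗ
        glTensorRep (Fin N) k n g =
      glTensorRep σ k n (reindexGL e g) ∘ₗ (PiTensorProduct.congr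
        (fun _ : Fin n => LinearEquiv.funCongrLeft k k e.symm.toEquiv)).toLinearMap := by
    refine PiTensorProduct.ext (MultilinearMap.ext fun v => ?_)
    simp only [LinearMap.compMultilinearMap_apply, LinearMap.coe_comp, Function.comp_apply,
      LinearEquiv.coe_coe, glTensorRep_tprod, PiTensorProduct.congr_tprod, coe_reindexGL,
      funCongrLeft_mulVec]
  exact DFunLike.congr_fun h x

/-- `reindexGL e` is onto: `g = reindexGL e (reindex e⁻¹ e⁻¹ g)`. [folklore] -/
private theorem exists_reindexGL_eq (g : GL σ k) : ∃ h : GL (Fin N) k, reindexGL e h = g := by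
  refine ⟨Units.map (MonoidHomClass.toMonoidHom (Matrix.reindexAlgEquiv k k e.symm.toEquiv)) g,
    Units.ext ?_⟩
  have hE : ∀ i, e.symm.toEquiv.symm (e.symm i) = i := fun i => e.symm.toEquiv.symm_apply_apply i
  rw [coe_reindexGL, Units.coe_map]
  ext i j
  simp only [MonoidHom.coe_coe, Matrix.coe_reindexAlgEquiv, Matrix.reindex_apply,
    Matrix.submatrix_apply, hE]

/-- **The two renderings of `dim (S_λ W)^H` agree.** For an order isomorphism `e : Fin N ≃o σ`, a
subgroup `H ≤ GL_σ(k)` and `λ ⊢ n`: the dimension of the `H`-invariants of the Schur functor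
`S_λ(k^σ) = schurRep (stdRep σ k) λ` (the rendering of the named facts `BLMW2011_prop_5_2_1_invariants`,
`BLMW2011_prop_5_5_2_invariants`) equals `IK2020.weylInvariantDim k N λ (e^* H)`, the dimension of the
invariants of `e^* H = H.comap (reindexGL e)` in the `Fin N`-indexed Weyl module `{λ}` (the rendering of
the tree's proved orbit-closure bounds). Both are BLMW's `dim V_λ^H` of (4.1.2) = IK's `dim {λ}^H` of
(9.4). [cite: BurgisserEtAl2011, §4.1 (4.1.2)] [cite: IkenmeyerKandasamy2019, §9 eq. (9.4)] -/
theorem finrank_subgroupInvariants_schurRep_stdRep_eq_weylInvariantDim (H : Subgroup (GL σ k))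
    (lam : Nat.Partition n) :
    Module.finrank k (subgroupInvariants (V := schurModule k (σ → k) lam)
        (schurRep (stdRep σ k) lam) H) =
      IK2020.weylInvariantDim k N lam (H.comap (reindexGL e)) := by
  classical
  -- the relabelling of tensors, kept opaque (`Φ = congr (funCongrLeft e⁻¹)^{⊗n}`)
  obtain ⟨Φ, hΦ⟩ : ∃ Φ : TensorPower k n (Fin N → k) ≃ₗ[k] TensorPower k n (σ → k),
      Φ = PiTensorProduct.congr (fun _ : Fin n => LinearEquiv.funCongrLeft k k e.symm.toEquiv) :=
    ⟨_, rfl⟩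
  have hΦmem : ∀ (μ : Nat.Partition n) (x : TensorPower k n (Fin N → k)),
      Φ x ∈ schurModule k (σ → k) μ ↔ x ∈ schurModule k (Fin N → k) μ := by
    intro μ x
    rw [hΦ]
    exact congr_mem_schurModule_iff _ μ x
  have hΦgl : ∀ (g : GL (Fin N) k) (x : TensorPower k n (Fin N → k)),
      Φ (glTensorRep (Fin N) k n g x) = glTensorRep σ k n (reindexGL e g) (Φ x) := by
    intro g x
    rw [hΦ]
    exact congr_glTensorRep e g x
  set A := Representation.invariants (k := k) (G := H.comap (reindexGL e))
    (V := weylModule k (Fin N) lam) ((weylRep k (Fin N) lam).comp (H.comap (reindexGL e)).subtype)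
    with hA
  set B := subgroupInvariants (V := schurModule k (σ → k) lam) (schurRep (stdRep σ k) lam) H with hB
  have key : (A.map (weylModule k (Fin N) lam).subtype).map (Φ : _ →ₗ[k] _) =
      B.map (schurModule k (σ → k) lam).subtype := by
    apply le_antisymm
    · rintro _ ⟨_, ⟨y, hy, rfl⟩, rfl⟩
      have hmem : Φ (y : TensorPower k n (Fin N → k)) ∈ schurModule k (σ → k) lam :=
        (hΦmem lam _).2 y.2
      refine ⟨⟨Φ y, hmem⟩, ?_, rfl⟩
      rw [hB, SetLike.mem_coe, mem_subgroupInvariants_iff]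
      intro g hg
      apply Subtype.ext
      rw [coe_schurRep_apply, tensorDiagRep_stdRep]
      obtain ⟨h, rfl⟩ := exists_reindexGL_eq e g
      have hfix : glTensorRep (Fin N) k n h (y : TensorPower k n (Fin N → k)) = y := by
        have h1 := (Representation.mem_invariants _ _).1 hy ⟨h, Subgroup.mem_comap.2 hg⟩
        have h2 := congrArg Subtype.val h1
        rwa [MonoidHom.coe_comp, Function.comp_apply, coe_weylRep_apply] at h2
      change glTensorRep σ k n (reindexGL e h) (Φ y) = Φ y
      rw [← hΦgl, hfix]
    · rintro _ ⟨z, hz, rfl⟩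
      have hyz : Φ (Φ.symm (z : TensorPower k n (σ → k))) = z := Φ.apply_symm_apply _
      have hmem : Φ.symm (z : TensorPower k n (σ → k)) ∈ weylModule k (Fin N) lam := by
        rw [← schurModule_eq_weylModule]
        rw [← hΦmem lam, hyz]
        exact z.2
      refine ⟨Φ.symm z, ⟨⟨Φ.symm z, hmem⟩, ?_, rfl⟩, hyz⟩
      rw [hA, SetLike.mem_coe, Representation.mem_invariants]
      intro h'
      apply Subtype.ext
      rw [MonoidHom.coe_comp, Function.comp_apply, coe_weylRep_apply]
      change glTensorRep (Fin N) k n (h' : GL (Fin N) k) (Φ.symm z) = Φ.symm z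
      apply Φ.injective
      rw [hΦgl, hyz]
      have h1 := (mem_subgroupInvariants_iff.1 hz) (reindexGL e (h' : GL (Fin N) k)) h'.2
      have h2 := congrArg Subtype.val h1
      rwa [coe_schurRep_apply, tensorDiagRep_stdRep] at h2
  -- count: `dim B = dim Φ(A) = dim A`
  have hdim : Module.finrank k (A.map (weylModule k (Fin N) lam).subtype) =
      Module.finrank k (B.map (schurModule k (σ → k) lam).subtype) :=
    ((Φ.submoduleMap (A.map (weylModule k (Fin N) lam).subtype)).trans
      (LinearEquiv.ofEq _ _ key)).finrank_eq
  rw [← Submodule.finrank_map_subtype_eq _ B, ← hdim, Submodule.finrank_map_subtype_eq, hA]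
  rfl

/-- **The orbit-closure multiplicity is bounded by the stabilizer invariants, in BLMW's letters**
(characteristic zero): for every form `f` on the lexicographically ordered matrix space `Mat_m`
(variables `MatIdx m`), every degree `D` and every `λ` with `ℓ(λ) ≤ m²`,
`mult_{λ^*} k[\overline{GL(W)·f}]_D ≤ dim (S_λW)^{GL(W)(f)}` with the right side in the
`subgroupInvariants (schurRep (stdRep (MatIdx m) k) λ) (linStabilizer f)` rendering of the named facts.
This is "`ℂ[\overline{GL(W)·f}]_δ ⊆ ℂ[GL(W)·f]_δ`" (BLMW (5.2.7), (5.5.3): "immediate") combined with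
(4.1.2) "`ℂ[G/H] = ⊕_λ (V_λ^*)^{⊕ dim V_λ^H}`"; the proof is Ikenmeyer–Kandasamy's bound
(`IK2020.orbitMultiplicity_toMatIdx_le_weylInvariantDim`) transported by
`finrank_subgroupInvariants_schurRep_stdRep_eq_weylInvariantDim`.
[cite: BurgisserEtAl2011, §4.1 (4.1.2) with §5.2 (5.2.7)] [cite: IkenmeyerKandasamy2019, §1 (TeX L247)] -/
theorem orbitMultiplicity_toMatIdx_le_finrank_subgroupInvariants [CharZero k] {m : ℕ}
    (f : MvPolynomial (MatIdx m) k) (D : ℕ) (lam : Nat.Partition n) (hlam : lam.parts.card ≤ m * m) :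
    orbitMultiplicity k f D (Weight.dualOfPartition (m * m) lam).toMatIdx ≤
      Module.finrank k (subgroupInvariants (V := schurModule k (MatIdx m → k) lam)
        (schurRep (stdRep (MatIdx m) k) lam) (linStabilizer f)) := by
  rw [finrank_subgroupInvariants_schurRep_stdRep_eq_weylInvariantDim (matIdxEquiv m)]
  exact IK2020.orbitMultiplicity_toMatIdx_le_weylInvariantDim k f D lam hlam

end Transport

/-! ### §2 The permanent: Prop. 5.5.2 in the literal rendering -/

section Permanent

open IK2020

/-- **`dim (S_λW)^{GL(W)(per_m)} ≤ perOrbitCeiling λ`** in the literal rendering (any field of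
characteristic zero, `m ≥ 1`, `λ ⊢ m·d`, `ℓ(λ) ≤ m²`): `weylInvariantDim_per_le_perOrbitCeiling`
transported. BLMW (5.5.2) via (4.1.2): the left side is the orbit-ring multiplicity `mult_π`.
[cite: BurgisserEtAl2011, Prop. 5.5.2 (5.5.2)] -/
theorem finrank_subgroupInvariants_per_le_perOrbitCeiling (k : Type*) [Field k] [CharZero k]
    (m : ℕ) [NeZero m] {d : ℕ} (lam : Nat.Partition (m * d)) (hlam : lam.parts.card ≤ m * m) :
    Module.finrank k (subgroupInvariants (V := schurModule k (MatIdx m → k) lam)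
        (schurRep (stdRep (MatIdx m) k) lam) (linStabilizer (paddedPerFormLex k m m))) ≤
      perOrbitCeiling k m d lam := by
  rw [finrank_subgroupInvariants_schurRep_stdRep_eq_weylInvariantDim (matIdxEquiv m)]
  exact weylInvariantDim_per_le_perOrbitCeiling k m lam hlam

/-- **`dim (S_λW)^{GL(W)(per_m)} = perOrbitCeiling λ` over `ℂ` for `m ≥ 3`** in the literal rendering
of `BLMW2011_prop_5_5_2_invariants`: the left side of BLMW (5.5.2) (via (4.1.2)) IS the proved ceiling
of `BLMW11PerOrbitCeiling.lean` (`perOrbitCeiling_eq_weylInvariantDim`, Marcus–May, transported).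
[cite: BurgisserEtAl2011, Prop. 5.5.2 (5.5.2)] -/
theorem perOrbitCeiling_eq_finrank_subgroupInvariants (m : ℕ) [NeZero m] (hm : 3 ≤ m) {d : ℕ}
    (lam : Nat.Partition (m * d)) (hlam : lam.parts.card ≤ m * m) :
    perOrbitCeiling ℂ m d lam =
      Module.finrank ℂ (subgroupInvariants (V := schurModule ℂ (MatIdx m → ℂ) lam)
        (schurRep (stdRep (MatIdx m) ℂ) lam) (linStabilizer (paddedPerFormLex ℂ m m))) := by
  rw [finrank_subgroupInvariants_schurRep_stdRep_eq_weylInvariantDim (matIdxEquiv m)]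
  exact perOrbitCeiling_eq_weylInvariantDim m hm lam hlam

/-- **What remains of BLMW (5.5.2) is a numerical identity**: the dimension formula of Prop. 5.5.2
via (4.1.2) — "`dim S_π(W)^{GL(W)(per_m)} = mult_π`", AS PROVED (corrected `mult_π`), spelled out for
`m ≥ 3`, `0 < δ`, `π ⊢ mδ` with `ℓ(π) ≤ m²` (the first conjunct of the named fact
`BLMW2011_prop_5_5_2_invariants` in its degree-guarded reading, ERRATUM A19; at `δ = 0` the tree's
`BLMW2011.multPer ℂ m 0 ∅` is the junk value `0`) — is equivalent to
`perOrbitCeiling ℂ m δ π = BLMW2011.multPer ℂ m δ π` for the same `m, δ, π`. By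
`two_mul_factorial_mul_perOrbitCeiling` the left side is given by the character sum
`∑_τ χ^π(τ)(χ₀(τ)² + χ₀(τ²)) / (2·(mδ)!)`; the identity is BLMW's Cor. 8.4.2 (`χ₀ = ∑_μ p_μ χ^μ`)
followed by character orthogonality, not proved in this file. [cite: BurgisserEtAl2011, Prop. 5.5.2 (5.5.2)] -/
theorem BLMW2011_per_invariants_iff_perOrbitCeiling :
    (∀ (m δ : ℕ) [NeZero m] (π : Nat.Partition (m * δ)), 3 ≤ m → 0 < δ → π.parts.card ≤ m * m →
        Module.finrank ℂ (subgroupInvariants (V := schurModule ℂ (MatIdx m → ℂ) π)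
          (schurRep (stdRep (MatIdx m) ℂ) π) (linStabilizer (paddedPerFormLex ℂ m m))) =
          BLMW2011.multPer ℂ m δ π) ↔
      ∀ (m δ : ℕ) [NeZero m] (π : Nat.Partition (m * δ)), 3 ≤ m → 0 < δ → π.parts.card ≤ m * m →
        perOrbitCeiling ℂ m δ π = BLMW2011.multPer ℂ m δ π := by
  refine forall₂_congr fun m δ => forall_congr' fun _ => forall₃_congr fun π hm _ =>
    forall_congr' fun hπ => ?_
  rw [perOrbitCeiling_eq_finrank_subgroupInvariants m hm π hπ]

/-- **BLMW 2011, Prop. 5.5.2: (5.5.3) follows from (5.5.2)** ("Equation (5.5.3) is now immediate as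
`ℂ[\overline{GL(W)·per_m}]_δ ⊆ ℂ[GL(W)·per_m]_δ`"), on the spelled-out sentences in their degree-guarded
reading (`0 < δ`, ERRATUM A19): the dimension formula "`dim S_π(W)^{GL(W)(per_m)} = mult_π`" (AS PROVED)
implies the orbit-closure bound "`mult_{π^*} ℂ[\overline{GL(W)·per_m}]_m ≤ mult_π`"
(`orbitMultiplicity_toMatIdx_le_finrank_subgroupInvariants`) — the contents of the named facts
`BLMW2011_prop_5_5_2_invariants` (first conjunct) and `BLMW2011_prop_5_5_2_closure`.
[cite: BurgisserEtAl2011, Prop. 5.5.2 (5.5.3)] -/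
theorem BLMW2011_per_closure_of_invariants
    (h : ∀ (m δ : ℕ) [NeZero m] (π : Nat.Partition (m * δ)), 3 ≤ m → 0 < δ → π.parts.card ≤ m * m →
      Module.finrank ℂ (subgroupInvariants (V := schurModule ℂ (MatIdx m → ℂ) π)
        (schurRep (stdRep (MatIdx m) ℂ) π) (linStabilizer (paddedPerFormLex ℂ m m))) =
        BLMW2011.multPer ℂ m δ π)
    (m δ : ℕ) [NeZero m] (π : Nat.Partition (m * δ)) (hm : 3 ≤ m) (hδ : 0 < δ)
    (hπ : π.parts.card ≤ m * m) :
    orbitMultiplicity ℂ (paddedPerFormLex ℂ m m) m (Weight.dualOfPartition (m * m) π).toMatIdx ≤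
      BLMW2011.multPer ℂ m δ π := by
  rw [← h m δ π hm hδ hπ]
  exact orbitMultiplicity_toMatIdx_le_finrank_subgroupInvariants (paddedPerFormLex ℂ m m) m π hπ

/-- **What remains of `BLMW2011_prop_5_5_2_invariants` is a numerical identity** (by name; the fact in
its degree-guarded reading `0 < δ`, ERRATUM A19): the named fact (BLMW (5.5.2) via (4.1.2), AS PROVED:
corrected `mult_π`; its divisibility conjunct is the proved `BLMW2011_prop_5_5_2_invariants_right`) is
equivalent to `perOrbitCeiling ℂ m δ π = BLMW2011.multPer ℂ m δ π` for all `m ≥ 3`, `δ ≥ 1`, `π ⊢ mδ`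
with `ℓ(π) ≤ m²` (`BLMW2011_per_invariants_iff_perOrbitCeiling`). [cite: BurgisserEtAl2011, Prop. 5.5.2 (5.5.2)] -/
theorem BLMW2011_prop_5_5_2_invariants_iff_perOrbitCeiling :
    BLMW2011_prop_5_5_2_invariants ↔
      ∀ (m δ : ℕ) [NeZero m] (π : Nat.Partition (m * δ)), 3 ≤ m → 0 < δ → π.parts.card ≤ m * m →
        perOrbitCeiling ℂ m δ π = BLMW2011.multPer ℂ m δ π :=
  Iff.trans BLMW2011_prop_5_5_2_invariants_iff BLMW2011_per_invariants_iff_perOrbitCeiling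

/-- **BLMW 2011, Prop. 5.5.2: (5.5.3) follows from (5.5.2)**, for the named facts (degree-guarded
reading, ERRATUM A19): `BLMW2011_prop_5_5_2_invariants` implies `BLMW2011_prop_5_5_2_closure`
("Equation (5.5.3) is now immediate as `ℂ[\overline{GL(W)·per_m}]_δ ⊆ ℂ[GL(W)·per_m]_δ`";
`BLMW2011_per_closure_of_invariants`). [cite: BurgisserEtAl2011, Prop. 5.5.2 (5.5.3)] -/
theorem BLMW2011_prop_5_5_2_closure_of_invariants (h : BLMW2011_prop_5_5_2_invariants) :
    BLMW2011_prop_5_5_2_closure :=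
  fun m δ _ π hm hδ hπ => BLMW2011_per_closure_of_invariants h.1 m δ π hm hδ hπ

/-- **The orbit-closure bound of the permanent in the literal rendering, unconditionally** (`ℂ`,
any `m ≥ 1`): `mult_{π^*} ℂ[\overline{GL(W)·per_m}]_m ≤ dim (S_πW)^{GL(W)(per_m)}` (for `m ≥ 3` the
right side `= perOrbitCeiling ℂ m δ π`, `perOrbitCeiling_eq_finrank_subgroupInvariants`) — the content
of (5.5.3) ("immediate as `ℂ[\overline{GL(W)·per_m}]_δ ⊆ ℂ[GL(W)·per_m]_δ`") with the orbit-ring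
multiplicity `dim (S_πW)^{GL(W)(per_m)}` of (4.1.2) in place of the closed formula `mult_π`.
[cite: BurgisserEtAl2011, Prop. 5.5.2 (5.5.3)] -/
theorem orbitMultiplicity_per_le_finrank_subgroupInvariants (m δ : ℕ) [NeZero m]
    (π : Nat.Partition (m * δ)) (hπ : π.parts.card ≤ m * m) :
    orbitMultiplicity ℂ (paddedPerFormLex ℂ m m) m (Weight.dualOfPartition (m * m) π).toMatIdx ≤
      Module.finrank ℂ (subgroupInvariants (V := schurModule ℂ (MatIdx m → ℂ) π)
        (schurRep (stdRep (MatIdx m) ℂ) π) (linStabilizer (paddedPerFormLex ℂ m m))) :=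
  orbitMultiplicity_toMatIdx_le_finrank_subgroupInvariants (paddedPerFormLex ℂ m m) m π hπ

end Permanent

/-! ### §3 The determinant: Prop. 5.2.1 in the literal rendering -/

section Determinant

open IK2020

/-- **`dim (S_λW)^{GL(W)(det_n)} ≤ symKroneckerCoeffRect λ`** in the literal rendering of
`BLMW2011_prop_5_2_1_invariants` (any field of characteristic zero, `λ ⊢ n·d`, `ℓ(λ) ≤ n²`): t08's
`IK2020.weylInvariantDim_det_le_symKroneckerCoeffRect` transported. BLMW (5.2.6) prints EQUALITY with
`sk^π_{δⁿδⁿ}`; the tree's `symKroneckerCoeffRect` is its bound-space rendering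
(`DetOrbitSymKroneckerBound.lean`), not syntactically `symKroneckerCoeff _ π (δⁿ)`.
[cite: BurgisserEtAl2011, Prop. 5.2.1 (5.2.6)] -/
theorem finrank_subgroupInvariants_det_le_symKroneckerCoeffRect (k : Type*) [Field k] [CharZero k]
    {n d : ℕ} (lam : Nat.Partition (n * d)) (hlam : lam.parts.card ≤ n * n) :
    Module.finrank k (subgroupInvariants (V := schurModule k (MatIdx n → k) lam)
        (schurRep (stdRep (MatIdx n) k) lam) (linStabilizer (detFormLex k n))) ≤
      symKroneckerCoeffRect k n d lam := by
  rw [finrank_subgroupInvariants_schurRep_stdRep_eq_weylInvariantDim (matIdxEquiv n)]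
  exact weylInvariantDim_det_le_symKroneckerCoeffRect k lam hlam

/-- **BLMW 2011, Prop. 5.2.1: (5.2.7) follows from (5.2.6)** ("Equation (5.2.7) is now immediate as
`ℂ[\overline{GL(W)·det_n}]_δ ⊆ ℂ[GL(W)·det_n]_δ`"), for the named fact as typed: the orbit-ring fact
`BLMW2011_prop_5_2_1_invariants` implies
`mult_{π^*} ℂ[\overline{GL(W)·det_n}]_n ≤ sk^π_{δⁿδⁿ} = symKroneckerCoeff ℂ π (δⁿ)` with BLMW's (5.2.5)
`sk` (the tree's unconditional `orbitMultiplicity_det_le_symKroneckerCoeffRect` has the bound-space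
`symKroneckerCoeffRect` on the right instead). [cite: BurgisserEtAl2011, Prop. 5.2.1 (5.2.7)] -/
theorem BLMW2011_prop_5_2_1_closure_of_invariants (h : BLMW2011_prop_5_2_1_invariants) (n δ : ℕ)
    (π : Nat.Partition (n * δ)) (hπ : π.parts.card ≤ n * n) :
    orbitMultiplicity ℂ (detFormLex ℂ n) n (Weight.dualOfPartition (n * n) π).toMatIdx ≤
      symKroneckerCoeff ℂ π (Nat.Partition.rectangle n δ) := by
  rw [← h.1 n δ π hπ]
  exact orbitMultiplicity_toMatIdx_le_finrank_subgroupInvariants (detFormLex ℂ n) n π hπ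

end Determinant


/-! ### §4 `symKroneckerCoeffRect = sk^λ_{□□}`; BLMW (5.2.7) as printed, unconditionally -/

section RectangleSk

variable (k : Type*) [Field k] [CharZero k]

/-- **The two renderings of the rectangular symmetric Kronecker coefficient agree**: for `λ ⊢ m·d`
with `ℓ(λ) ≤ m²`, the tree's bound-space `symKroneckerCoeffRect k m d λ`
(`DetOrbitSymKroneckerBound.lean`, `dim T_S`) equals BLMW's `sk^λ_{□□} = dim Hom_{𝔖_{md}}([λ], Sym²[□])`
of (5.2.5), `symKroneckerCoeff k λ (d^m)`: both satisfy `2·(md)!·x = ∑_τ χ^λ(τ)(χ^□(τ)² + χ^□(τ²))`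
(`two_mul_factorial_mul_symKroneckerCoeffRect`, `two_mul_factorial_mul_symKroneckerCoeff`).
[cite: BurgisserEtAl2011, §5.2 (5.2.5)] -/
theorem symKroneckerCoeffRect_eq_symKroneckerCoeff {m d : ℕ} (lam : Nat.Partition (m * d))
    (hlam : lam.parts.card ≤ m * m) :
    symKroneckerCoeffRect k m d lam = symKroneckerCoeff k lam (Nat.Partition.rectangle m d) := by
  have h1 := two_mul_factorial_mul_symKroneckerCoeffRect k lam hlam
  have h2 := two_mul_factorial_mul_symKroneckerCoeff k lam (Nat.Partition.rectangle m d)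
  have h : 2 * (m * d).factorial * symKroneckerCoeffRect k m d lam =
      2 * (m * d).factorial * symKroneckerCoeff k lam (Nat.Partition.rectangle m d) := by
    exact_mod_cast h1.trans h2.symm
  exact Nat.eq_of_mul_eq_mul_left (by positivity) h

/-- **BLMW 2011, Prop. 5.2.1 (5.2.7), exactly as printed — proved unconditionally**:
"`ℂ[\overline{GL(W)·det_n}]_δ ⊆ ⊕_{π : |π| = nδ} (S_πW^*)^{⊕ sk^π_{δⁿδⁿ}}`", i.e. for `π ⊢ nδ` with
`ℓ(π) ≤ n²` the multiplicity of `π^*` in `k[\overline{GL_{n²}·det_n}]_n` is at most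
`sk^π_{δⁿδⁿ} = symKroneckerCoeff k π (δⁿ)` with the `sk` of (5.2.5) (`dim Hom_{𝔖}([π], Sym²[δⁿ])`), over
any field of characteristic zero: the tree's `orbitMultiplicity_det_le_symKroneckerCoeffRect` with
`symKroneckerCoeffRect_eq_symKroneckerCoeff`. (The conditional `BLMW2011_prop_5_2_1_closure_of_invariants`
of §3 derives the same from the orbit-ring fact, as the paper does.) [cite: BurgisserEtAl2011, Prop. 5.2.1 (5.2.7)] -/
theorem orbitMultiplicity_det_le_symKroneckerCoeff {n δ : ℕ} (π : Nat.Partition (n * δ))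
    (hπ : π.parts.card ≤ n * n) :
    orbitMultiplicity k (detFormLex k n) n (Weight.dualOfPartition (n * n) π).toMatIdx ≤
      symKroneckerCoeff k π (Nat.Partition.rectangle n δ) := by
  rw [← symKroneckerCoeffRect_eq_symKroneckerCoeff k π hπ]
  exact orbitMultiplicity_det_le_symKroneckerCoeffRect k n π hπ

/-- **The `≤` half of BLMW (5.2.6) in the letters of `BLMW2011_prop_5_2_1_invariants`** (any field of
characteristic zero): `dim (S_πW)^{GL(W)(det_n)} ≤ sk^π_{δⁿδⁿ}` — every unimodular `a ⊗ b` and the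
transposition stabilize `det_n`, so stabilizer-fixed tensors are family-fixed
(`finrank_subgroupInvariants_det_le_symKroneckerCoeffRect` with `symKroneckerCoeffRect_eq_symKroneckerCoeff`).
The printed EQUALITY needs the converse containment, i.e. Frobenius' description of the stabilizer
(the fact `frobenius_detPreserver_unimodular_sandwich`). [cite: BurgisserEtAl2011, Prop. 5.2.1 (5.2.6)] -/
theorem finrank_subgroupInvariants_det_le_symKroneckerCoeff {n δ : ℕ} (π : Nat.Partition (n * δ))
    (hπ : π.parts.card ≤ n * n) :
    Module.finrank k (subgroupInvariants (V := schurModule k (MatIdx n → k) π)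
        (schurRep (stdRep (MatIdx n) k) π) (linStabilizer (detFormLex k n))) ≤
      symKroneckerCoeff k π (Nat.Partition.rectangle n δ) := by
  rw [← symKroneckerCoeffRect_eq_symKroneckerCoeff k π hπ]
  exact finrank_subgroupInvariants_det_le_symKroneckerCoeffRect k π hπ

/-- **What remains of `BLMW2011_prop_5_2_1_invariants` is the reverse inequality**: the named fact
(BLMW (5.2.6) via (4.1.2), with its proved divisibility conjunct `BLMW2011_prop_5_2_1_invariants_right`)
is equivalent to `sk^π_{δⁿδⁿ} ≤ dim (S_πW)^{GL(W)(det_n)}` for all `n, δ` and `π ⊢ nδ` with `ℓ(π) ≤ n²`.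
[cite: BurgisserEtAl2011, Prop. 5.2.1 (5.2.6)] -/
theorem BLMW2011_prop_5_2_1_invariants_iff_symKroneckerCoeff_le :
    BLMW2011_prop_5_2_1_invariants ↔
      ∀ (n δ : ℕ) (π : Nat.Partition (n * δ)), π.parts.card ≤ n * n →
        symKroneckerCoeff ℂ π (Nat.Partition.rectangle n δ) ≤
          Module.finrank ℂ (subgroupInvariants (V := schurModule ℂ (MatIdx n → ℂ) π)
            (schurRep (stdRep (MatIdx n) ℂ) π) (linStabilizer (detFormLex ℂ n))) := by
  rw [BLMW2011_prop_5_2_1_invariants_iff]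
  refine forall₃_congr fun n δ π => forall_congr' fun hπ => ?_
  exact ⟨fun h => h.symm.le,
    fun h => le_antisymm (finrank_subgroupInvariants_det_le_symKroneckerCoeff ℂ π hπ) h⟩

end RectangleSk

end Literature.Computability.AlgebraicComplexity
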